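import Summits.QuantumFields.YangMills.Theorems.FluctuationComparisonRegPrIntLOrganTangentFibreMeanTools
import Summits.QuantumFields.YangMills.Theorems.FluctuationComparisonRegPrIntLOrganTangentCumulantTailTools
import Summits.QuantumFields.YangMills.Theorems.BalabanUVNodesN09DomAltThresholdNull
import Literature.MathematicalPhysics.QuantumFieldTheory.Balaban1983to89.T3UnitScaleTilt
import Literature.MathematicalPhysics.QuantumFieldTheory.Balaban1983to89.T3UnitLawDensityEML
import Literature.MathematicalPhysics.QuantumFieldTheory.Balaban1983to89.T3OrbitAverage
import HarnessLib

/-!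
# Crux `FluctuationComparisonRegPrIntL` (stmt-QuantumFields-20520, rung R3), PATH-B organ O1 v17.2, LINE g26-2 «jensen_cumulant» (ideator ym-r3-idea-1 g26), rows
# VAR∘ `FibreVarianceCan` ∕ LME3∘ `CumulantRemainderCan` — THE SUPPORT KNIT: with the CONTINUOUS versions `m` (fibre mean) and `v` (fibre second moment,
# repair R-VAR) the cumulant split is, POINTWISE on the window, `q = ½·Var[h; P_V]` and `g − q = ∫₀¹ ((1−t)²∕2)·⟨h³⟩ᵀ_{P_V,t} dt`

LEAD-20520 width seat ym-ust-20520-w3 g23 (cell ym3-torus), `--supports stmt-QuantumFields-20520` (helper).  THEOREMS ONLY, def-free, generic cut `cW`.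

WHAT.  ★★`cumulantSplit_eq_integral_truncExp`: the frame and hypotheses of ✓`…OrganTangentJensenGapKnit.jensenGap_eq_integral_variance` (O1's frame at a
step below the seed — both towers SF-projected —, JEN∘'s `W`-continuous `m` with its a.e. σ-identity, the (A)-package `(σ₀, λ; A1 A2 A3)` at `cW`) PLUS
the R-VAR letter of LINE g26-2 v1.1-to-be: a `W`-continuous `v` with `v V = (∫ χ h² r′ dσ_V)∕(∫ χ r′ dσ_V)` for `dU_j`-a.e. window `V` (inhabited from (A):
✓`…OrganTangentSecondMomentVersion`).  THEN for EVERY window `V`, with `P_V := (χ·r′)·λ_V`, `h = log r − log r′`: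
(i) `t ↦ ⟨h³⟩ᵀ_{P_V,t} := truncExp h (P_V.tilted (t·h)) 3` is continuous; (ii) `v V − (m V)² = Var[h; P_V.tilted 0]` (the χ-conditioned fibre variance of
the REFERENCE law — VAR∘'s `q = ½(v − m²)` is half of it); (iii) `(log rj V − log rj′ V − m V) − ½(v V − (m V)²) = ∫₀¹ ((1−t)²∕2)·⟨h³⟩ᵀ_{P_V,t} dt` —
LME3∘'s cumulant tail IS the integrated tilted third truncated expectation ([Balaban1982Higgs1] (3.23); ✓`B10Eq24Cumulant.truncExp_tilted`).  Hence, after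
R-VAR: VAR∘ ⟸ (A) ∧ «window clustering of `V ↦ Var[h; P_V.tilted 0]`» (factor ½) and LME3∘ ⟸ (A) ∧ «t-uniform window clustering of `V ↦ ⟨h³⟩ᵀ_{P_V,t}`»
(factor 1∕6, ✓`…CumulantTailTools.abs_fourPoint_le_of_eq_integral_sq`).  Proof = the JEN∘ knit's identifications (disintegration-density, Radon–Nikodym,
uniqueness, (A3), transfer, «a.e. ⇒ everywhere on the open window») run for `χ·h·r′` AND `χ·h²·r′`, then Mathlib `iteratedDeriv_two_cgf` ∕ `variance_tilted_mul`
at `0` and ✓`…CumulantTailTools.cgf_taylor_three_integral_truncExp`.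

HONEST FRAMING: measure theory∕calculus over hypothesis letters; nothing of Bałaban's analysis is asserted or proved; (A), VAR∘, LME3∘, JEN∘, VER∘ (rows),
O1, crux 20520, `YM3TorusSU2` are NOT proved; registry `Lines/semiclassical_s2beta.lean` v11.4 (★★OWNER RULING №36) untouched and nothing here is
registered; rung R3 = SU(2) YM₃ on T³ — NOT d = 4, NOT infinite volume, NOT a mass gap, NOT Clay; the Yang–Mills mass gap is NOT proved by any of this.
-/

set_option autoImplicit false

noncomputable section

namespace Summit.QuantumFields.YangMills.Theorems.OrganTangentCumulantTailKnit

open MeasureTheory ProbabilityTheory Filter Topology Set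
open scoped ENNReal
open Literature.MathematicalPhysics.QuantumFieldTheory.Balaban1983to89
open T3ContinuumYM3Torus T3NestedUnitLaws T3UnitLawDensityEML T3UnitScaleTilt
open Literature.MathematicalPhysics.QuantumFieldTheory.Balaban1983to89.T3OrbitAverage
open Summit.QuantumFields.YangMills.Theorems.OrganTangentFibreMeanTools
open Summit.QuantumFields.YangMills.Theorems.OrganTangentJensenGapTools
open Summit.QuantumFields.YangMills.Theorems.OrganTangentCumulantTailTools
open Literature.MathematicalPhysics.QuantumFieldTheory.Balaban1983to89 (B10Eq24Cumulant.truncExp)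
open Summit.QuantumFields.YangMills.BalabanUVNodes.N09DomAltThresholdNull (isOpen_setOf_plaqSmall_SU)

/-- ★★ **THE CUMULANT SPLIT OF THE JENSEN GAP, POINTWISE ON THE WINDOW.**  Hypotheses = ✓`jensenGap_eq_integral_variance`'s (frame below the seed,
(A)-package at `cW`, JEN∘'s continuous `m` with its a.e. σ-identity) + the R-VAR letter (continuous `v` with its a.e. σ-identity for `χ·h²·r′`).
Conclusion, for every `V ∈ W` (`P_V := (χ·r′)·λ_V`, `h = log r − log r′`): `t ↦ ⟨h³⟩ᵀ_{P_V,t}` is continuous; `v V − (m V)² = Var[h; P_V.tilted 0]`;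
`(log rj V − log rj′ V − m V) − ½(v V − (m V)²) = ∫₀¹ ((1−t)²∕2)·⟨h³⟩ᵀ_{P_V,t} dt`. [cite: Balaban1987RG1, §2 p.264; Balaban1982Higgs1, (3.23)-(3.24) p.616] -/
theorem cumulantSplit_eq_integral_truncExp
    (F : T3Family) (γ b₀ p₀ : ℝ) (j : ℕ) (hθ : 0 < θBal F.L γ b₀ p₀ (j + 1)) (cW : ℝ) (hcW : cW < 1)
    (r r' : GaugeField (F.P (j + 1)) 0 ↥(Matrix.specialUnitaryGroup (Fin 2) ℂ) → ℝ) (hrm : Measurable r) (hrm' : Measurable r')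
    (rj rj' : GaugeField (F.P j) 0 ↥(Matrix.specialUnitaryGroup (Fin 2) ℂ) → ℝ) (hrjm : Measurable rj) (hrjm' : Measurable rj')
    (hpos : ∀ U, PlaqSmall (θBal F.L γ b₀ p₀ (j + 1)) U → 0 < r U ∧ 0 < r' U)
    (hr : ContinuousOn r {U | PlaqSmall (θBal F.L γ b₀ p₀ (j + 1)) U})
    (hr' : ContinuousOn r' {U | PlaqSmall (θBal F.L γ b₀ p₀ (j + 1)) U})
    (hrjpos : ∀ V, PlaqSmall (θBal F.L γ b₀ p₀ j) V → 0 < rj V ∧ 0 < rj' V)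
    (hrjc : ContinuousOn rj {V | PlaqSmall (θBal F.L γ b₀ p₀ j) V})
    (hrjc' : ContinuousOn rj' {V | PlaqSmall (θBal F.L γ b₀ p₀ j) V})
    (χ : GaugeField (F.P (j + 1)) 0 ↥(Matrix.specialUnitaryGroup (Fin 2) ℂ) → ℝ) (hχc : Continuous χ) (hχ0 : ∀ U, 0 ≤ χ U)
    (hχsupp : ∀ U, χ U ≠ 0 → PlaqSmall (cW * θBal F.L γ b₀ p₀ (j + 1)) U)
    (hχpos : ∀ U, PlaqSmall (cW * θBal F.L γ b₀ p₀ (j + 1)) U → 0 < χ U)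
    (hcons : (((fieldMeasure (F.P (j + 1)) 0 ↥(Matrix.specialUnitaryGroup (Fin 2) ℂ)).withDensity
        (fun U => ENNReal.ofReal (r U))).withDensity (fun U => ENNReal.ofReal (χ U))).map (descend F ℰp j) =
      (fieldMeasure (F.P j) 0 ↥(Matrix.specialUnitaryGroup (Fin 2) ℂ)).withDensity (fun V => ENNReal.ofReal (rj V)))
    (hcons' : (((fieldMeasure (F.P (j + 1)) 0 ↥(Matrix.specialUnitaryGroup (Fin 2) ℂ)).withDensity
        (fun U => ENNReal.ofReal (r' U))).withDensity (fun U => ENNReal.ofReal (χ U))).map (descend F ℰp j) =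
      (fieldMeasure (F.P j) 0 ↥(Matrix.specialUnitaryGroup (Fin 2) ℂ)).withDensity (fun V => ENNReal.ofReal (rj' V)))
    (σ : Kernel (GaugeField (F.P j) 0 ↥(Matrix.specialUnitaryGroup (Fin 2) ℂ))
      (GaugeField (F.P (j + 1)) 0 ↥(Matrix.specialUnitaryGroup (Fin 2) ℂ)))
    (hσM : IsMarkovKernel σ)
    (hbind : (Measure.map (descend F ℰp j) (fieldMeasure (F.P (j + 1)) 0 ↥(Matrix.specialUnitaryGroup (Fin 2) ℂ))).bind ⇑σ =
      fieldMeasure (F.P (j + 1)) 0 ↥(Matrix.specialUnitaryGroup (Fin 2) ℂ))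
    (hfib : ∀ᵐ V ∂(Measure.map (descend F ℰp j) (fieldMeasure (F.P (j + 1)) 0 ↥(Matrix.specialUnitaryGroup (Fin 2) ℂ))),
      ∀ᵐ U ∂(σ V), descend F ℰp j U = V)
    (m : GaugeField (F.P j) 0 ↥(Matrix.specialUnitaryGroup (Fin 2) ℂ) → ℝ)
    (hmc : ContinuousOn m {V | PlaqSmall (θBal F.L γ b₀ p₀ j) V})
    (hm : ∀ᵐ V ∂(fieldMeasure (F.P j) 0 ↥(Matrix.specialUnitaryGroup (Fin 2) ℂ)), PlaqSmall (θBal F.L γ b₀ p₀ j) V →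
      Integrable (fun U => χ U * (Real.log (r U) - Real.log (r' U)) * r' U) (σ V) ∧
        m V = (∫ U, χ U * (Real.log (r U) - Real.log (r' U)) * r' U ∂(σ V)) / (∫ U, χ U * r' U ∂(σ V)))
    (v : GaugeField (F.P j) 0 ↥(Matrix.specialUnitaryGroup (Fin 2) ℂ) → ℝ)
    (hvc : ContinuousOn v {V | PlaqSmall (θBal F.L γ b₀ p₀ j) V})
    (hv : ∀ᵐ V ∂(fieldMeasure (F.P j) 0 ↥(Matrix.specialUnitaryGroup (Fin 2) ℂ)), PlaqSmall (θBal F.L γ b₀ p₀ j) V →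
      Integrable (fun U => χ U * (Real.log (r U) - Real.log (r' U)) ^ 2 * r' U) (σ V) ∧
        v V = (∫ U, χ U * (Real.log (r U) - Real.log (r' U)) ^ 2 * r' U ∂(σ V)) / (∫ U, χ U * r' U ∂(σ V)))
    (σ₀ : Kernel (GaugeField (F.P j) 0 ↥(Matrix.specialUnitaryGroup (Fin 2) ℂ))
      (GaugeField (F.P (j + 1)) 0 ↥(Matrix.specialUnitaryGroup (Fin 2) ℂ)))
    (hσ₀M : IsMarkovKernel σ₀)
    (hbind₀ : (Measure.map (descend F ℰp j) (fieldMeasure (F.P (j + 1)) 0 ↥(Matrix.specialUnitaryGroup (Fin 2) ℂ))).bind ⇑σ₀ =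
      fieldMeasure (F.P (j + 1)) 0 ↥(Matrix.specialUnitaryGroup (Fin 2) ℂ))
    (hfib₀ : ∀ᵐ V ∂(Measure.map (descend F ℰp j) (fieldMeasure (F.P (j + 1)) 0 ↥(Matrix.specialUnitaryGroup (Fin 2) ℂ))),
      ∀ᵐ U ∂(σ₀ V), descend F ℰp j U = V)
    (lam : GaugeField (F.P j) 0 ↥(Matrix.specialUnitaryGroup (Fin 2) ℂ) →
      Measure (GaugeField (F.P (j + 1)) 0 ↥(Matrix.specialUnitaryGroup (Fin 2) ℂ)))
    (hlam : ∀ V, IsFiniteMeasure (lam V))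
    (hA1 : ∀ f : GaugeField (F.P (j + 1)) 0 ↥(Matrix.specialUnitaryGroup (Fin 2) ℂ) → ℝ, Continuous f →
      (∀ U, f U ≠ 0 → PlaqSmall (cW * θBal F.L γ b₀ p₀ (j + 1)) U) →
      ContinuousOn (fun V => ∫ U, f U ∂(lam V)) {V | PlaqSmall (θBal F.L γ b₀ p₀ j) V})
    (hA2 : ∀ V, PlaqSmall (θBal F.L γ b₀ p₀ j) V → 0 < lam V {U | PlaqSmall (cW * θBal F.L γ b₀ p₀ (j + 1)) U})
    (hA3 : ∃ c : GaugeField (F.P j) 0 ↥(Matrix.specialUnitaryGroup (Fin 2) ℂ) → ℝ,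
      ∀ f : GaugeField (F.P (j + 1)) 0 ↥(Matrix.specialUnitaryGroup (Fin 2) ℂ) → ℝ, Continuous f →
        (∀ U, ¬ PlaqSmall (cW * θBal F.L γ b₀ p₀ (j + 1)) U → f U = 0) →
        ∀ᵐ V ∂(Measure.map (descend F ℰp j) (fieldMeasure (F.P (j + 1)) 0 ↥(Matrix.specialUnitaryGroup (Fin 2) ℂ))),
          PlaqSmall (θBal F.L γ b₀ p₀ j) V → 0 < c V ∧ ∫ U, f U ∂(σ₀ V) = c V * ∫ U, f U ∂(lam V)) :
    ∀ V, PlaqSmall (θBal F.L γ b₀ p₀ j) V →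
      Continuous (fun t : ℝ => B10Eq24Cumulant.truncExp (fun U => Real.log (r U) - Real.log (r' U))
          ((((lam V).withDensity (fun U => ENNReal.ofReal (χ U * r' U))).tilted
            (fun U => t * (Real.log (r U) - Real.log (r' U))))) 3) ∧
      v V - m V ^ 2 =
        variance (fun U => Real.log (r U) - Real.log (r' U))
          (((lam V).withDensity (fun U => ENNReal.ofReal (χ U * r' U))).tilted
            (fun U => (0 : ℝ) * (Real.log (r U) - Real.log (r' U)))) ∧
      Real.log (rj V) - Real.log (rj' V) - m V - 1 / 2 * (v V - m V ^ 2) =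
        ∫ t in (0 : ℝ)..1, (1 - t) ^ 2 / 2 *
          B10Eq24Cumulant.truncExp (fun U => Real.log (r U) - Real.log (r' U))
            ((((lam V).withDensity (fun U => ENNReal.ofReal (χ U * r' U))).tilted
              (fun U => t * (Real.log (r U) - Real.log (r' U))))) 3 := by
  haveI := hσM
  haveI := hσ₀M
  haveI : BorelSpace (GaugeField (F.P (j + 1)) 0 ↥(Matrix.specialUnitaryGroup (Fin 2) ℂ)) :=
    T3OrbitAverage.instBorelSpaceGaugeField
  haveI : BorelSpace (GaugeField (F.P j) 0 ↥(Matrix.specialUnitaryGroup (Fin 2) ℂ)) :=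
    T3OrbitAverage.instBorelSpaceGaugeField
  -- abbreviations
  set θ' : ℝ := θBal F.L γ b₀ p₀ (j + 1) with hθ'
  set θj : ℝ := θBal F.L γ b₀ p₀ j with hθj
  set Hf : Measure (GaugeField (F.P (j + 1)) 0 ↥(Matrix.specialUnitaryGroup (Fin 2) ℂ)) :=
    fieldMeasure (F.P (j + 1)) 0 ↥(Matrix.specialUnitaryGroup (Fin 2) ℂ) with hHf
  set Hc : Measure (GaugeField (F.P j) 0 ↥(Matrix.specialUnitaryGroup (Fin 2) ℂ)) :=
    fieldMeasure (F.P j) 0 ↥(Matrix.specialUnitaryGroup (Fin 2) ℂ) with hHc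
  haveI : IsProbabilityMeasure Hf := Missing.isProbabilityMeasure_fieldMeasure _ _
  haveI : IsProbabilityMeasure Hc := Missing.isProbabilityMeasure_fieldMeasure _ _
  haveI : Hc.IsOpenPosMeasure := B12ContinuousTransportInvariance.isOpenPosMeasure_fieldMeasure_SU 2 (F.P j) 0
  haveI : Nonempty (GaugeField (F.P (j + 1)) 0 ↥(Matrix.specialUnitaryGroup (Fin 2) ℂ)) := ⟨fun _ => 1⟩
  have hd : Measurable (descend F ℰp j :
      GaugeField (F.P (j + 1)) 0 ↥(Matrix.specialUnitaryGroup (Fin 2) ℂ) →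
        GaugeField (F.P j) 0 ↥(Matrix.specialUnitaryGroup (Fin 2) ℂ)) :=
    T3NestedUnitLaws.measurable_descend F ℰp measurableE_ℰp j
  -- the windows
  set O : Set (GaugeField (F.P (j + 1)) 0 ↥(Matrix.specialUnitaryGroup (Fin 2) ℂ)) := {U | PlaqSmall θ' U} with hO
  set O₃ : Set (GaugeField (F.P (j + 1)) 0 ↥(Matrix.specialUnitaryGroup (Fin 2) ℂ)) := {U | PlaqSmall (cW * θ') U} with hO₃
  set W : Set (GaugeField (F.P j) 0 ↥(Matrix.specialUnitaryGroup (Fin 2) ℂ)) := {V | PlaqSmall θj V} with hW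
  have hOopen : IsOpen O := isOpen_setOf_plaqSmall_SU 2 (F.P (j + 1)) 0 θ'
  have hWopen : IsOpen W := isOpen_setOf_plaqSmall_SU 2 (F.P j) 0 θj
  have hWm : MeasurableSet W := hWopen.measurableSet
  have hχts : tsupport χ ⊆ O := tsupport_subset_plaqSmall (mul_lt_of_lt_one_left hθ hcW) hχsupp
  have hO₃O : O₃ ⊆ O := fun U hU p => (hU p).trans (mul_lt_of_lt_one_left hθ hcW)
  have hχm : Measurable χ := hχc.measurable
  -- the discrepancy and the three localised integrands, globally continuous
  set hfun : GaugeField (F.P (j + 1)) 0 ↥(Matrix.specialUnitaryGroup (Fin 2) ℂ) → ℝ :=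
    fun U => Real.log (r U) - Real.log (r' U) with hhfun
  have hhc : ContinuousOn hfun O :=
    (hr.log fun U hU => (hpos U hU).1.ne').sub (hr'.log fun U hU => (hpos U hU).2.ne')
  have hhm : Measurable hfun := (Real.measurable_log.comp hrm).sub (Real.measurable_log.comp hrm')
  set f₁ : GaugeField (F.P (j + 1)) 0 ↥(Matrix.specialUnitaryGroup (Fin 2) ℂ) → ℝ := fun U => χ U * (hfun U * r' U) with hf₁
  set f₄ : GaugeField (F.P (j + 1)) 0 ↥(Matrix.specialUnitaryGroup (Fin 2) ℂ) → ℝ := fun U => χ U * (hfun U ^ 2 * r' U) with hf₄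
  set f₂ : GaugeField (F.P (j + 1)) 0 ↥(Matrix.specialUnitaryGroup (Fin 2) ℂ) → ℝ := fun U => χ U * r' U with hf₂
  set f₃ : GaugeField (F.P (j + 1)) 0 ↥(Matrix.specialUnitaryGroup (Fin 2) ℂ) → ℝ := fun U => χ U * r U with hf₃
  have hf₁c : Continuous f₁ := continuous_mul_of_tsupport_subset hOopen hχc hχts (hhc.mul hr')
  have hf₄c : Continuous f₄ := continuous_mul_of_tsupport_subset hOopen hχc hχts ((hhc.pow 2).mul hr')
  have hf₂c : Continuous f₂ := continuous_mul_of_tsupport_subset hOopen hχc hχts hr'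
  have hf₃c : Continuous f₃ := continuous_mul_of_tsupport_subset hOopen hχc hχts hr
  have hf₁eq : (fun U => χ U * (Real.log (r U) - Real.log (r' U)) * r' U) = f₁ := by
    funext U; simp only [hf₁, hhfun]; ring
  have hf₄eq : (fun U => χ U * (Real.log (r U) - Real.log (r' U)) ^ 2 * r' U) = f₄ := by
    funext U; simp only [hf₄, hhfun]; ring
  have hf₁supp : ∀ U, f₁ U ≠ 0 → PlaqSmall (cW * θ') U := fun U hU => hχsupp U (left_ne_zero_of_mul hU)
  have hf₄supp : ∀ U, f₄ U ≠ 0 → PlaqSmall (cW * θ') U := fun U hU => hχsupp U (left_ne_zero_of_mul hU)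
  have hf₂supp : ∀ U, f₂ U ≠ 0 → PlaqSmall (cW * θ') U := fun U hU => hχsupp U (left_ne_zero_of_mul hU)
  have hf₃supp : ∀ U, f₃ U ≠ 0 → PlaqSmall (cW * θ') U := fun U hU => hχsupp U (left_ne_zero_of_mul hU)
  have hf₁zero : ∀ U, U ∉ O₃ → f₁ U = 0 := fun U hU => by by_contra h; exact hU (hf₁supp U h)
  have hf₄zero : ∀ U, U ∉ O₃ → f₄ U = 0 := fun U hU => by by_contra h; exact hU (hf₄supp U h)
  have hf₂zero : ∀ U, U ∉ O₃ → f₂ U = 0 := fun U hU => by by_contra h; exact hU (hf₂supp U h)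
  have hf₃zero : ∀ U, U ∉ O₃ → f₃ U = 0 := fun U hU => by by_contra h; exact hU (hf₃supp U h)
  have hf₂nn : ∀ U, 0 ≤ f₂ U := by
    intro U
    by_cases hU : χ U = 0
    · simp only [hf₂, hU, zero_mul, le_refl]
    · exact mul_nonneg (hχ0 U) (hpos U (hO₃O (hχsupp U hU))).2.le
  have hf₃nn : ∀ U, 0 ≤ f₃ U := by
    intro U
    by_cases hU : χ U = 0
    · simp only [hf₃, hU, zero_mul, le_refl]
    · exact mul_nonneg (hχ0 U) (hpos U (hO₃O (hχsupp U hU))).1.le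
  have hf₂O₃ : ∀ U, U ∈ O₃ → f₂ U ≠ 0 := fun U hU => mul_ne_zero (hχpos U hU).ne' (hpos U (hO₃O hU)).2.ne'
  have hf₃O₃ : ∀ U, U ∈ O₃ → f₃ U ≠ 0 := fun U hU => mul_ne_zero (hχpos U hU).ne' (hpos U (hO₃O hU)).1.ne'
  -- on the support of `χ`: `r′·e^{h} = r`, so `f₂·e^{h} = f₃`; and `f₂·h = f₁`
  have hf₂exp : ∀ U, f₂ U * Real.exp (hfun U) = f₃ U := by
    intro U
    by_cases hU : χ U = 0
    · simp only [hf₂, hf₃, hU, zero_mul]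
    · have hUO : U ∈ O := hO₃O (hχsupp U hU)
      have h1 : Real.exp (hfun U) = r U / r' U := by
        simp only [hhfun]; rw [Real.exp_sub, Real.exp_log (hpos U hUO).1, Real.exp_log (hpos U hUO).2]
      simp only [hf₂, hf₃]; rw [h1, mul_assoc, mul_div_cancel₀ _ (hpos U hUO).2.ne']
  -- the λ-integrals: numerator, denominator, unprimed numerator; continuity and positivity on `W`
  set num : GaugeField (F.P j) 0 ↥(Matrix.specialUnitaryGroup (Fin 2) ℂ) → ℝ := fun V => ∫ U, f₁ U ∂(lam V) with hnum
  set sec : GaugeField (F.P j) 0 ↥(Matrix.specialUnitaryGroup (Fin 2) ℂ) → ℝ := fun V => ∫ U, f₄ U ∂(lam V) with hsec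
  set den : GaugeField (F.P j) 0 ↥(Matrix.specialUnitaryGroup (Fin 2) ℂ) → ℝ := fun V => ∫ U, f₂ U ∂(lam V) with hden
  set nup : GaugeField (F.P j) 0 ↥(Matrix.specialUnitaryGroup (Fin 2) ℂ) → ℝ := fun V => ∫ U, f₃ U ∂(lam V) with hnup
  have hnumc : ContinuousOn num W := hA1 f₁ hf₁c hf₁supp
  have hsecc : ContinuousOn sec W := hA1 f₄ hf₄c hf₄supp
  have hdenc : ContinuousOn den W := hA1 f₂ hf₂c hf₂supp
  have hnupc : ContinuousOn nup W := hA1 f₃ hf₃c hf₃supp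
  have hpos_of : ∀ {f : GaugeField (F.P (j + 1)) 0 ↥(Matrix.specialUnitaryGroup (Fin 2) ℂ) → ℝ}, Continuous f →
      (∀ U, 0 ≤ f U) → (∀ U, U ∈ O₃ → f U ≠ 0) → ∀ V, V ∈ W → 0 < ∫ U, f U ∂(lam V) := by
    intro f hfc hfnn hfO₃ V hV
    haveI := hlam V
    have hint : Integrable f (lam V) := integrable_of_continuous_compact hfc (lam V)
    refine (integral_pos_iff_support_of_nonneg_ae (Eventually.of_forall hfnn) hint).mpr ?_
    exact (hA2 V hV).trans_le (measure_mono fun U hU => Function.mem_support.mpr (hfO₃ U hU))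
  have hdenpos : ∀ V, V ∈ W → 0 < den V := hpos_of hf₂c hf₂nn hf₂O₃
  have hnuppos : ∀ V, V ∈ W → 0 < nup V := hpos_of hf₃c hf₃nn hf₃O₃
  obtain ⟨c, hc⟩ := hA3
  ------------------------------------------------------------------
  -- STEP A: `rj·den = rj′·nup` on `W` (disintegration computes the push-forward densities; a.e. ⇒ everywhere)
  ------------------------------------------------------------------
  set ν : Measure (GaugeField (F.P j) 0 ↥(Matrix.specialUnitaryGroup (Fin 2) ℂ)) := Hf.map (descend F ℰp j) with hν
  -- the frame's double density is the single density `χ·r` (resp. `χ·r′`)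
  have hdd : ∀ (ρ : GaugeField (F.P (j + 1)) 0 ↥(Matrix.specialUnitaryGroup (Fin 2) ℂ) → ℝ), Measurable ρ →
      (∀ U, χ U ≠ 0 → 0 ≤ ρ U) →
      (Hf.withDensity (fun U => ENNReal.ofReal (ρ U))).withDensity (fun U => ENNReal.ofReal (χ U)) =
        Hf.withDensity (fun U => ENNReal.ofReal (χ U * ρ U)) := by
    intro ρ hρm hρnn
    rw [← withDensity_mul _ hρm.ennreal_ofReal hχm.ennreal_ofReal]
    refine withDensity_congr_ae (Eventually.of_forall fun U => ?_)
    show (fun U => ENNReal.ofReal (ρ U)) U * (fun U => ENNReal.ofReal (χ U)) U = ENNReal.ofReal (χ U * ρ U)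
    simp only
    by_cases hU : χ U = 0
    · simp [hU]
    · rw [← ENNReal.ofReal_mul (hρnn U hU), mul_comm]
  have hr_nn : ∀ U, χ U ≠ 0 → 0 ≤ r U := fun U hU => (hpos U (hO₃O (hχsupp U hU))).1.le
  have hr'_nn : ∀ U, χ U ≠ 0 → 0 ≤ r' U := fun U hU => (hpos U (hO₃O (hχsupp U hU))).2.le
  rw [hdd r hrm hr_nn] at hcons
  rw [hdd r' hrm' hr'_nn] at hcons'
  -- disintegration: `(f·Hf).map descend = (V ↦ ∫⁻ f dσ₀_V)·ν`
  have hdis3 := map_withDensity_eq_withDensity_lintegral Hf hd σ₀ hbind₀ hfib₀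
    hf₃c.measurable.ennreal_ofReal
  have hdis2 := map_withDensity_eq_withDensity_lintegral Hf hd σ₀ hbind₀ hfib₀
    hf₂c.measurable.ennreal_ofReal
  -- Radon–Nikodym: `ν = Z·Hc`
  have hνac : ν ≪ Hc := absolutelyContinuous_map_descend F j
  set Z : GaugeField (F.P j) 0 ↥(Matrix.specialUnitaryGroup (Fin 2) ℂ) → ℝ≥0∞ := ν.rnDeriv Hc with hZ
  have hZm : Measurable Z := Measure.measurable_rnDeriv ν Hc
  have hνZ : Hc.withDensity Z = ν := Measure.withDensity_rnDeriv_eq ν Hc hνac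
  set G₃ : GaugeField (F.P j) 0 ↥(Matrix.specialUnitaryGroup (Fin 2) ℂ) → ℝ≥0∞ :=
    fun V => ∫⁻ U, ENNReal.ofReal (f₃ U) ∂(σ₀ V) with hG₃
  set G₂ : GaugeField (F.P j) 0 ↥(Matrix.specialUnitaryGroup (Fin 2) ℂ) → ℝ≥0∞ :=
    fun V => ∫⁻ U, ENNReal.ofReal (f₂ U) ∂(σ₀ V) with hG₂
  have hG₃m : Measurable G₃ := hf₃c.measurable.ennreal_ofReal.lintegral_kernel
  have hG₂m : Measurable G₂ := hf₂c.measurable.ennreal_ofReal.lintegral_kernel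
  have hae3 : (fun V => ENNReal.ofReal (rj V)) =ᵐ[Hc] Z * G₃ := by
    rw [← withDensity_eq_iff_of_sigmaFinite hrjm.ennreal_ofReal.aemeasurable (hZm.mul hG₃m).aemeasurable,
      withDensity_mul _ hZm hG₃m, hνZ, ← hdis3, hcons]
  have hae2 : (fun V => ENNReal.ofReal (rj' V)) =ᵐ[Hc] Z * G₂ := by
    rw [← withDensity_eq_iff_of_sigmaFinite hrjm'.ennreal_ofReal.aemeasurable (hZm.mul hG₂m).aemeasurable,
      withDensity_mul _ hZm hG₂m, hνZ, ← hdis2, hcons']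
  -- (A3) on `f₃`, `f₂`, transferred from `ν`-a.e. to `Hc`-a.e. on `W` through `hcons'` (`rj′ > 0` on `W`)
  have hWne' : ∀ V ∈ W, ENNReal.ofReal (rj' V) ≠ 0 := fun V hV => (ENNReal.ofReal_pos.mpr (hrjpos V hV).2).ne'
  have hρX' : AEMeasurable (fun V => ENNReal.ofReal (rj' V)) Hc := hrjm'.ennreal_ofReal.aemeasurable
  have hA3W : ∀ᵐ V ∂Hc, V ∈ W → (0 < c V ∧ ∫ U, f₃ U ∂(σ₀ V) = c V * nup V ∧ ∫ U, f₂ U ∂(σ₀ V) = c V * den V) := by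
    have h : ∀ᵐ V ∂ν, V ∈ W → (0 < c V ∧ ∫ U, f₃ U ∂(σ₀ V) = c V * nup V ∧ ∫ U, f₂ U ∂(σ₀ V) = c V * den V) := by
      filter_upwards [hc f₃ hf₃c hf₃zero, hc f₂ hf₂c hf₂zero] with V h3 h2 hV
      exact ⟨(h3 hV).1, (h3 hV).2, (h2 hV).2⟩
    have h' := ae_on_of_ae_map_of_withDensity_eq Hf hd Hc (fun U => ENNReal.ofReal (f₂ U)) hρX' hcons' hWne' h
    filter_upwards [h'] with V hV hVW
    exact hV hVW hVW
  -- lintegral of a nonneg continuous function on a probability fibre = ofReal of its integral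
  have hGof : ∀ {f : GaugeField (F.P (j + 1)) 0 ↥(Matrix.specialUnitaryGroup (Fin 2) ℂ) → ℝ}, Continuous f → (∀ U, 0 ≤ f U) →
      ∀ V, ∫⁻ U, ENNReal.ofReal (f U) ∂(σ₀ V) = ENNReal.ofReal (∫ U, f U ∂(σ₀ V)) := by
    intro f hfc hfnn V
    rw [ofReal_integral_eq_lintegral_ofReal (integrable_of_continuous_compact hfc (σ₀ V)) (Eventually.of_forall hfnn)]
  have hprod : ∀ᵐ V ∂Hc, V ∈ W → rj V * den V = rj' V * nup V := by
    filter_upwards [hae3, hae2, hA3W] with V h3 h2 hAV hV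
    obtain ⟨hc0, e3, e2⟩ := hAV hV
    have e3' : G₃ V = ENNReal.ofReal (c V * nup V) := by rw [hG₃]; simp only; rw [hGof hf₃c hf₃nn, e3]
    have e2' : G₂ V = ENNReal.ofReal (c V * den V) := by rw [hG₂]; simp only; rw [hGof hf₂c hf₂nn, e2]
    have hdenV : 0 ≤ den V := (hdenpos V hV).le
    have hnupV : 0 ≤ nup V := (hnuppos V hV).le
    have hk : ENNReal.ofReal (rj V * den V) = ENNReal.ofReal (rj' V * nup V) := by
      rw [ENNReal.ofReal_mul (hrjpos V hV).1.le, ENNReal.ofReal_mul (hrjpos V hV).2.le]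
      rw [show ENNReal.ofReal (rj V) = (Z * G₃) V from h3, show ENNReal.ofReal (rj' V) = (Z * G₂) V from h2]
      simp only [Pi.mul_apply]
      rw [e3', e2', mul_assoc, mul_assoc, ← ENNReal.ofReal_mul (mul_nonneg hc0.le hnupV),
        ← ENNReal.ofReal_mul (mul_nonneg hc0.le hdenV)]
      congr 2; ring
    exact (ENNReal.ofReal_eq_ofReal_iff (mul_nonneg (hrjpos V hV).1.le hdenV) (mul_nonneg (hrjpos V hV).2.le hnupV)).mp hk
  have hprodW : EqOn (fun V => rj V * den V) (fun V => rj' V * nup V) W :=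
    Measure.eqOn_open_of_ae_eq ((ae_restrict_iff' hWm).mpr hprod) hWopen (hrjc.mul hdenc) (hrjc'.mul hnupc)
  ------------------------------------------------------------------
  -- STEP B: `m = num∕den` on `W` (uniqueness of the disintegration + (A3) + transfer; a.e. ⇒ everywhere)
  ------------------------------------------------------------------
  have huniq : ∀ᵐ V ∂ν, σ V = σ₀ V := ae_eq_of_bind_of_bind Hf hd σ σ₀ hbind hfib hbind₀ hfib₀
  have hkey : ∀ᵐ V ∂ν, V ∈ W →
      (∫ U, χ U * (Real.log (r U) - Real.log (r' U)) * r' U ∂(σ V)) / (∫ U, χ U * r' U ∂(σ V)) = num V / den V := by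
    filter_upwards [huniq, hc f₁ hf₁c hf₁zero, hc f₂ hf₂c hf₂zero] with V hVσ hV1 hV2 hVW
    obtain ⟨hc0, hres1⟩ := hV1 hVW
    obtain ⟨-, hres2⟩ := hV2 hVW
    rw [hf₁eq, show (fun U => χ U * r' U) = f₂ from rfl, hVσ, hres1, hres2, mul_div_mul_left _ _ hc0.ne']
  have hmae : ∀ᵐ V ∂Hc, V ∈ W → m V = num V / den V := by
    have h1 := ae_on_of_ae_map_of_withDensity_eq Hf hd Hc (fun U => ENNReal.ofReal (f₂ U)) hρX' hcons' hWne' hkey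
    filter_upwards [h1, hm] with V hV hmV hVW
    rw [(hmV hVW).2, hV hVW hVW]
  have hmW : EqOn m (fun V => num V / den V) W :=
    Measure.eqOn_open_of_ae_eq ((ae_restrict_iff' hWm).mpr hmae) hWopen hmc (hnumc.div hdenc fun V hV => (hdenpos V hV).ne')
  -- STEP B′: `v = sec∕den` on `W` (the same argument with the integrand `χ·h²·r′`)
  have hkey₂ : ∀ᵐ V ∂ν, V ∈ W →
      (∫ U, χ U * (Real.log (r U) - Real.log (r' U)) ^ 2 * r' U ∂(σ V)) / (∫ U, χ U * r' U ∂(σ V)) = sec V / den V := by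
    filter_upwards [huniq, hc f₄ hf₄c hf₄zero, hc f₂ hf₂c hf₂zero] with V hVσ hV1 hV2 hVW
    obtain ⟨hc0, hres1⟩ := hV1 hVW
    obtain ⟨-, hres2⟩ := hV2 hVW
    rw [hf₄eq, show (fun U => χ U * r' U) = f₂ from rfl, hVσ, hres1, hres2, mul_div_mul_left _ _ hc0.ne']
  have hvae : ∀ᵐ V ∂Hc, V ∈ W → v V = sec V / den V := by
    have h1 := ae_on_of_ae_map_of_withDensity_eq Hf hd Hc (fun U => ENNReal.ofReal (f₂ U)) hρX' hcons' hWne' hkey₂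
    filter_upwards [h1, hv] with V hV hvV hVW
    rw [(hvV hVW).2, hV hVW hVW]
  have hvW : EqOn v (fun V => sec V / den V) W :=
    Measure.eqOn_open_of_ae_eq ((ae_restrict_iff' hWm).mpr hvae) hWopen hvc (hsecc.div hdenc fun V hV => (hdenpos V hV).ne')
  ------------------------------------------------------------------
  -- STEP C: the cumulant generating function of `h` under `P_V = (χ·r′)·λ_V`
  ------------------------------------------------------------------
  intro V hV
  haveI := hlam V
  set P : Measure (GaugeField (F.P (j + 1)) 0 ↥(Matrix.specialUnitaryGroup (Fin 2) ℂ)) :=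
    (lam V).withDensity (fun U => ENNReal.ofReal (χ U * r' U)) with hP
  have hPf₂ : P = (lam V).withDensity (fun U => ENNReal.ofReal (f₂ U)) := rfl
  have hf₂m : Measurable fun U => ENNReal.ofReal (f₂ U) := hf₂c.measurable.ennreal_ofReal
  have hf₂i : Integrable f₂ (lam V) := integrable_of_continuous_compact hf₂c (lam V)
  haveI : IsFiniteMeasure P := isFiniteMeasure_withDensity_ofReal hf₂i.2
  -- integrals against `P` are `f₂`-weighted λ-integrals
  have hPint : ∀ g : GaugeField (F.P (j + 1)) 0 ↥(Matrix.specialUnitaryGroup (Fin 2) ℂ) → ℝ,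
      ∫ U, g U ∂P = ∫ U, f₂ U * g U ∂(lam V) := by
    intro g
    rw [hPf₂, integral_withDensity_eq_integral_toReal_smul hf₂m (Eventually.of_forall fun _ => ENNReal.ofReal_lt_top)]
    refine integral_congr_ae (Eventually.of_forall fun U => ?_)
    simp only [smul_eq_mul, ENNReal.toReal_ofReal (hf₂nn U)]
  have hPuniv : P.real Set.univ = den V := by
    rw [measureReal_def, hPf₂, withDensity_apply _ MeasurableSet.univ, Measure.restrict_univ,
      ← ofReal_integral_eq_lintegral_ofReal hf₂i (Eventually.of_forall hf₂nn), ENNReal.toReal_ofReal (hdenpos V hV).le]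
  haveI : NeZero P := ⟨fun h0 => by
    have : P.real Set.univ = 0 := by rw [h0]; simp
    rw [hPuniv] at this; exact (hdenpos V hV).ne' this⟩
  -- `|h| ≤ B` on the support of `χ` (compact shell inside the open fine window), hence `P`-a.e.
  obtain ⟨B, hB⟩ : ∃ B, ∀ U ∈ {U : GaugeField (F.P (j + 1)) 0 ↥(Matrix.specialUnitaryGroup (Fin 2) ℂ) |
      ∀ p, dist1 (GaugeField.plaqHol U p) ≤ cW * θ'}, |hfun U| ≤ B := by
    have hK : IsCompact {U : GaugeField (F.P (j + 1)) 0 ↥(Matrix.specialUnitaryGroup (Fin 2) ℂ) |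
        ∀ p, dist1 (GaugeField.plaqHol U p) ≤ cW * θ'} := (isClosed_setOf_dist1_le (cW * θ')).isCompact
    have hKO : {U : GaugeField (F.P (j + 1)) 0 ↥(Matrix.specialUnitaryGroup (Fin 2) ℂ) |
        ∀ p, dist1 (GaugeField.plaqHol U p) ≤ cW * θ'} ⊆ O := fun U hU p => (hU p).trans_lt (mul_lt_of_lt_one_left hθ hcW)
    obtain ⟨B, hB⟩ := hK.exists_bound_of_continuousOn (hhc.mono hKO)
    exact ⟨B, fun U hU => by simpa [Real.norm_eq_abs] using hB U hU⟩
  have hBae : ∀ᵐ U ∂P, |hfun U| ≤ B := by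
    rw [hPf₂, ae_withDensity_iff hf₂m]
    refine Eventually.of_forall fun U hU => hB U fun p => ?_
    have hχU : χ U ≠ 0 := fun h0 => hU (by simp [hf₂, h0])
    exact (hχsupp U hχU p).le
  have hhP : AEMeasurable hfun P := hhm.aemeasurable
  have hint0 : (0 : ℝ) ∈ interior (integrableExpSet hfun P) :=
    B10Eq24Cumulant.mem_interior_integrableExpSet_of_abs_le hhP hBae 0
  -- `f(1) = log nup`, `f(0) = log den`, `f′(0) = num∕den`
  have hcgf1 : cgf hfun P 1 = Real.log (nup V) := by
    rw [B10Eq24Cumulant.cgf_one_eq, hPint]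
    show Real.log _ = Real.log (∫ U, f₃ U ∂(lam V))
    congr 1
    exact integral_congr_ae (Eventually.of_forall hf₂exp)
  have hcgf0 : cgf hfun P 0 = Real.log (den V) := by rw [cgf_zero', hPuniv]
  have hdcgf : deriv (cgf hfun P) 0 = num V / den V := by
    rw [deriv_cgf_zero hint0, hPuniv, hPint]
    congr 1
    exact integral_congr_ae (Eventually.of_forall fun U => by simp only [hf₁]; ring)
  -- second derivative at 0: `f″(0) = sec∕den − (num∕den)² = v − m²` and `= Var[h; P.tilted 0]`
  have hd2 : iteratedDeriv 2 (cgf hfun P) 0 = v V - m V ^ 2 := by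
    rw [iteratedDeriv_two_cgf hint0, hdcgf, hvW hV, hmW hV, mgf_zero', hPuniv, hPint]
    simp only [zero_mul, Real.exp_zero, mul_one]
    congr 2
    exact integral_congr_ae (Eventually.of_forall fun U => by simp only [hf₄]; ring)
  have hvar0 : variance hfun (P.tilted fun U => (0 : ℝ) * hfun U) = iteratedDeriv 2 (cgf hfun P) 0 :=
    variance_tilted_mul hint0
  -- assemble
  have hq : Real.log (rj V) - Real.log (rj' V) - m V = cgf hfun P 1 - cgf hfun P 0 - deriv (cgf hfun P) 0 := by
    rw [hcgf1, hcgf0, hdcgf, hmW hV]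
    have hk : rj V * den V = rj' V * nup V := hprodW hV
    have h1 : Real.log (rj V) + Real.log (den V) = Real.log (rj' V) + Real.log (nup V) := by
      rw [← Real.log_mul (hrjpos V hV).1.ne' (hdenpos V hV).ne', ← Real.log_mul (hrjpos V hV).2.ne' (hnuppos V hV).ne', hk]
    linarith
  obtain ⟨hcont3, htaylor3⟩ := OrganTangentCumulantTailTools.cgf_taylor_three_integral_truncExp hhP hBae
  refine ⟨hcont3, by rw [hvar0, hd2], ?_⟩
  rw [hq, ← hd2, show 1 / 2 * iteratedDeriv 2 (cgf hfun P) 0 = iteratedDeriv 2 (cgf hfun P) 0 / 2 by ring]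
  exact htaylor3

end Summit.QuantumFields.YangMills.Theorems.OrganTangentCumulantTailKnit

end
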